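import Summits.ResolutionOfSingularities.ResolutionOfSingularities.Theses.WildPurity
import Literature.AlgebraicGeometry.Resolution.AffineDomainDimension

/-!
# Disproof of `WildSymbol` (stmt-ResolutionOfSingularities-17133) — standing disprover's work file

Route `ResolutionOfSingularities/WildPurity` (refutation-shaped: `closes : WildSymbol → PurityTransfer →
¬ ResolutionOfSingularities`), crux #2 `WildSymbol` = THE WITNESS: `∃ p, k, K, O, R, α` with `α` in Kato's
symbolic `H³_p(K) = G ⧸ N`, `α` `W`-integral at every DIVISORIAL `W ⊇ R` centred inside the centre of `O`
(condition (D), `DivIntegral` below), yet `α ∉ Unr(O)` (condition (N)).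

## Findings (cycle 1, cdisprove seat, 2026-08-17)

NO KILL. The crux is existential; `¬ WildSymbol` is the universal statement "for every function field
`K/k` (k perfect), every valuation ring `O ⊇ k`, every affine model `R ⊆ O`: divisorially-integral-through-
the-centre ⇒ `O`-integral", i.e. VALUATIVE PURITY for `H³_p` WITHOUT local uniformization. By the analysis
below this is equivalent in strength to a purity theorem at non-uniformizable places; no handle exists in
print or in the tree (searched: see NOTES / item evidence). What this file DOES establish, kernel-checked:

1. `wildSymbol_iff` — the crux restated over NAMED pieces (`G`, `N`, `Unr`, `EssFiniteType`,
   `DivIntegral`; bodies verbatim, proof `Iff.rfl`): importers may rewrite the crux into this shape.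
2. TRANSCRIPTION AUDIT (by hand, recorded here; positive): `G ⧸ N ≅ Ω²_K / (dΩ¹_K + (C⁻¹ − 1)Ω²_K)`
   EXACTLY, by elementary algebra — `φ [a,b,c} = a·dlog b ∧ dlog c` kills the seven relation shapes
   ((4) alternation, (5) `b·dlog b ∧ dlog c = d(b·dlog c)`, (6) symmetric, (7) `= (C⁻¹−1)(a dlog b dlog c)`),
   and `ψ (a·db ∧ dc) = [abc, b, c}` is a well-defined inverse: Leibniz in each slot is free,
   additivity `d(b+b') = db + db'` reduces (with `u = b/(b+b')`, `v = 1−u`, coefficient `A`) to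
   `Au⊗u⊗c + Av⊗v⊗c ≡ −(Au⊗A⊗c + Av⊗A⊗c) = −A⊗A⊗c ∈ N` using only shape (5) (resp. (6) in slot 2),
   alternation is shape (4) and its polarisation, `dΩ¹ ↦` shape (5). So the typed group is Kato's
   `H¹(K, Ω²_log) = coker(C⁻¹ − 1)` on the nose: NO surplus junk in `G ⧸ N` (a surplus class invisible to
   all `Unr W` would have made the crux trivially TRUE), no missing relation (which would have made
   `PurityTransfer` false). Also `Unr(T)` for a LOCAL ring `T` equals the image of `Ω²_T` (every element of
   a local ring is a sum of two units), i.e. the image of `H³_p(T)` for `T` essentially smooth local.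
3. SANITY of the typed group: `p_nsmul_eq_zero` — `G ⧸ N` is `p`-torsion (`[pa,b,c} = [0,b,c} = 0`).
4. LOAD-BEARING / CALIBRATION lemmas (all sorry-free; landed copies under
   `Theorems/WildSymbol/Negative/` — `LoadBearing.lean` p151228 ACCEPTED, `HeightOneCentre.lean`):
   * `wildSymbol_false_without_divisorial` — drop "W is a DVR essentially of finite type" from the test
     class (test ALL valuation rings `W ⊇ R` centred inside the centre of `O`): FALSE, witness `W := O`.
     So any witness needs `O` OUTSIDE the test class: the divisorial restriction is the whole content.
   * `not_wildSymbol_with_divisorial_O` — the natural special case "O itself a divisorial DVR" is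
     impossible (same instance). Witness places are non-divisorial.
   * `Unr_top`, `ne_top_of_not_mem_Unr`, `not_wildSymbol_at_top` — `Unr(K) = everything`; the trivial
     valuation carries no witness; in any witness the centre `𝔪_O ∩ R ≠ 0`.
   * `eq_top_of_isAlgebraic`, `not_wildSymbol_of_isAlgebraic` — degenerate instance trdeg `K = 0`:
     a valuation ring containing `k` contains every `k`-integral element, so `K/k` algebraic forces
     `O = ⊤`; no witness. (Unconditional trdeg bound provable here: `≥ 1`; the route's "trdeg ≥ 4" uses
     CossartPiltant2019 + PurityTransfer, both unproved in the tree.)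
   * `not_wildSymbol_of_centre_height_le_one` — CALIBRATION (Krull–Akizuki, normal case, PROVED):
     on an integrally closed affine model `R` the centre `𝔮 = 𝔪_O ∩ R` of a witness has HEIGHT ≥ 2:
     if `ht 𝔮 ≤ 1` then `𝔮 ≠ 0` (else `O = ⊤`), `R_𝔮 ⊆ K` (explicit subring, `IsLocalization.AtPrime`)
     is Noetherian, integrally closed, local of Krull dimension `ht 𝔮 ≤ 1`, not a field, hence a DVR
     (`IsDiscreteValuationRing.TFAE` via `IsDedekindDomain`); `O` dominates it, so `O = R_𝔮`
     (`ValuationSubring.eq_self_or_eq_top_of_le`) is divisorial with `B := R` — a tested `W`.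
     So witnesses sit over points of codimension ≥ 2 of the normalisation (LocalCandidate's `R` is
     normal: its centre must have height ≥ 2 too).
   * `not_wildSymbol_of_trdeg_le_one_of_normal` — corollary: no witness on a NORMAL affine model of a
     function field of transcendence degree `≤ 1` (`dim R = trdeg ≤ 1`, Literature
     `ringKrullDim_le_of_fg_of_trdeg_le`, so every centre has height `≤ 1`). Work-file only (its import
     `AffineDomainDimension` sits in a Literature closure with unproved facts; the landed files avoid it).
5. NEAR-MISS (sorried, statement precise): trdeg `K ≤ 1` carries no witness for ARBITRARY `R` (would
   follow from 4 by normalising `R`; needs finiteness of normalisation of a f.g. `k`-domain or a separating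
   transcendence basis over perfect `k` — neither in Mathlib). Also not formalised: "centre regular ⇒
   no witness" (needs Gersten for `H¹(−, Ω²_log)`, not in the tree) and "trdeg ≤ 3 ⇒ no witness"
   (needs CossartPiltant2019 LU + the same Gersten argument).

## Why it resists (for ideators / the lead)

* A witness `(K, O, R, α)` forces FAILURE OF LOCAL UNIFORMIZATION of `O` over `R`: if some finitely
  generated `R ⊆ A ⊆ O` has `A_𝔮` regular (`𝔮 = 𝔪_O ∩ A`), the height-one localisations of `A_𝔮` are
  tested `W`'s (divisorial, contain `R`, centre `P ∩ R ⊆ 𝔪_O ∩ R`), Gersten exactness for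
  `H¹(−, Ω²_log)` on the essentially smooth local `A_𝔮` (Gros–Suwa 1988; Shiho 2007) puts `α` in
  `Im H³_p(A_𝔮) = Unr(A_𝔮)` (item 2), and `A_𝔮 ⊆ O` is local so `Unr(A_𝔮) ⊆ Unr(O)`. Hence
  CONSTRUCTING a witness is at least as hard as disproving LU in dimension ≥ 4, and REFUTING the crux
  is a purity theorem at non-uniformizable (defect) places — open both ways; the planner's label
  `open-problem` is accurate and the statement is an honest transcription (items 1–2).
* Cheap witness hunting is pointless below the frontier: centre regular ⇒ no witness (Gersten);
  trdeg ≤ 3 ⇒ no witness (CP2019 LU + the same argument); `O` Abhyankar ⇒ no witness (Knaf–Kuhlmann LU).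
  The typed centre condition (`𝔪_W ∩ R ⊆ 𝔪_O ∩ R`, i.e. divisors THROUGH the centre, not only those
  centred AT it) is the direction that makes this argument work; the opposite direction would admit
  cheap witnesses and was checked NOT to be what is typed.
* No norm/corestriction shortcut: pulling `α` back to a regular ALTERATION `X' → Spec R` (de Jong)
  makes it integral upstairs (Gersten at the regular centre of an extension `O'` of `O`), but coming
  back down multiplies by `[K' : K]`, which is divisible by `p` for the alterations available in
  characteristic `p` (Gabber's prime-to-ℓ refinement excludes ℓ = p), and `G ⧸ N` is `p`-torsion
  (`p_nsmul_eq_zero`) — the transfer kills everything. This is the precise sense in which the crux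
  sits behind the resolution / p-alteration frontier rather than behind a cohomological technicality.
* Line `birth` (Lines/birth.lean): `stub_periodicTransport` was attacked and is TRUE as stated (the
  seven relation shapes are stable under `FreeAbelianGroup.map (tripleMap σ)` for any ring automorphism
  `σ`, so `σ` acts on `G ⧸ N`; exhaustion + monotone tower + invariance give the five-line proof; no
  hypothesis of it is droppable except that (ii) may be weakened to "every finite subset of `O` lies in
  some `σⁿ S`"). `stub_selfSimilarGerm` is a strengthening of the crux and inherits all of the above.

## Attacks run (all negative = no kill)
junk models: `O = ⊤` (dead: `Unr ⊤ = ⊤`), `K = k` / `K/k` algebraic (dead: forces `O = ⊤`), `O`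
divisorial (dead: `W := O`), centre of height 1 (dead on paper: Krull–Akizuki), `R_𝔮` regular (dead on
paper: Gersten); vacuity of (D): the test class is never empty when `O ≠ ⊤` (height-one primes inside the
centre carry divisorial valuations of the normalisation), so (D) is a real constraint; transcription of
`N` (7 shapes) and of "divisorial" (`W = B_𝔭`, `B` f.g., `Frac B = K`, `ht 𝔭 = 1` ⇔ classical prime
divisor): faithful; literature for "valuative purity of `H^q_p` without resolution": none found
(Gersten/purity for `W_nΩ^q_log` is printed for smooth/regular schemes only; valuation-ring results —
Kelly–Morrow — are injectivity statements for `O` itself, not purity relative to divisorial places).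
-/

noncomputable section

-- single-conjunct summit: the doubled namespace component is mandated
set_option linter.dupNamespace false

namespace Summit.ResolutionOfSingularities.ResolutionOfSingularities.Cruxes.WildSymbol.Disproof

open Summit.ResolutionOfSingularities.ResolutionOfSingularities.Theses.WildPurity (WildSymbol)

/-! ## The route's `let`s as named declarations (bodies verbatim) -/

/-- Generators of Kato's symbolic `H³_p(K)`: triples `(a, b, c)`, `a ∈ K`, `b, c ∈ Kˣ`
(`[a,b,c} = a·dlog b ∧ dlog c`). Verbatim the route's `let G`. [cite: doi:10.1007/bfb0061904, §1] -/
abbrev G (K : Type) [Field K] : Type := FreeAbelianGroup (K × Kˣ × Kˣ)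

/-- Kato's seven relation shapes. Verbatim the route's `let N`. [cite: doi:10.1007/bf02831624, Lemma 4.2] -/
def N (p : ℕ) (K : Type) [Field K] : AddSubgroup (G K) :=
  AddSubgroup.closure { x | (∃ (a a' : K) (b c : Kˣ), x = .of (a + a', b, c) - .of (a, b, c) - .of (a', b, c)) ∨ (∃ (a : K) (b b' c : Kˣ), x = .of (a, b * b', c) - .of (a, b, c) - .of (a, b', c)) ∨ (∃ (a : K) (b c c' : Kˣ), x = .of (a, b, c * c') - .of (a, b, c) - .of (a, b, c')) ∨ (∃ (a : K) (b : Kˣ), x = .of (a, b, b)) ∨ (∃ (b c : Kˣ), x = .of ((b : K), b, c)) ∨ (∃ (b c : Kˣ), x = .of ((c : K), b, c)) ∨ (∃ (a : K) (b c : Kˣ), x = .of (a ^ p - a, b, c)) }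

/-- `Unr p K T`: the subgroup of `G ⧸ N` generated by `T`-integral symbols (`a ∈ T`, `b, c ∈ Tˣ`).
Verbatim the route's `let Unr`. [cite: doi:10.1007/bf02831624, Lemma 4.2] -/
def Unr (p : ℕ) (K : Type) [Field K] (T : Subring K) : AddSubgroup (G K ⧸ N p K) :=
  AddSubgroup.closure { y | ∃ (a : K) (b c : Kˣ), a ∈ T ∧ (b : K) ∈ T ∧ ((b⁻¹ : Kˣ) : K) ∈ T ∧ (c : K) ∈ T ∧ ((c⁻¹ : Kˣ) : K) ∈ T ∧ y = ((FreeAbelianGroup.of (a, b, c) : G K) : G K ⧸ N p K) }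

/-- "`W` is essentially of finite type over `k`": a localisation of a finitely generated `k`-subalgebra
`B ⊆ W` (verbatim the crux's clause). [folklore] -/
def EssFiniteType (k K : Type) [Field k] [Field K] [Algebra k K] (W : ValuationSubring K) : Prop :=
  ∃ B : Subalgebra k K, B.FG ∧ B.toSubring ≤ W.toSubring ∧
    ∀ x : K, x ∈ W → ∃ b s : K, b ∈ B ∧ s ∈ B ∧ s ∉ W.nonunits ∧ x * s = b

/-- Condition (D) of the crux, verbatim: `α` is `W`-integral at every divisorial valuation ring `W` of
`K/k` containing `R` whose centre on `R` lies inside the centre of `O`. [cite: doi:10.1215/s0012-7094-88-05727-4] -/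
def DivIntegral (p : ℕ) (k K : Type) [Field k] [Field K] [Algebra k K] (R : Subalgebra k K)
    (O : ValuationSubring K) (α : G K ⧸ N p K) : Prop :=
  ∀ W : ValuationSubring K, (∀ c : k, algebraMap k K c ∈ W) → IsDiscreteValuationRing W →
    EssFiniteType k K W → R.toSubring ≤ W.toSubring →
    (∀ x : K, x ∈ R → x ∈ W.nonunits → x ∈ O.nonunits) → α ∈ Unr p K W.toSubring

/-- **The crux over the named pieces** (definitional unfolding of the route's `let`s; `Iff.rfl`). [folklore] -/
theorem wildSymbol_iff : WildSymbol ↔ ∃ p : ℕ, p.Prime ∧ ∃ (k K : Type) (_ : Field k) (_ : CharP k p)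
    (_ : PerfectField k) (_ : Field K) (_ : Algebra k K), (⊤ : IntermediateField k K).FG ∧
    ∃ O : ValuationSubring K, (∀ c : k, algebraMap k K c ∈ O) ∧ ∃ R : Subalgebra k K, R.FG ∧
    R.toSubring ≤ O.toSubring ∧ IsFractionRing R K ∧
    ∃ α : G K ⧸ N p K, DivIntegral p k K R O α ∧ α ∉ Unr p K O.toSubring :=
  Iff.rfl

/-! ## Elementary structure of `G ⧸ N` and `Unr` -/

variable {p : ℕ} {K : Type} [Field K]

/-- An integral symbol lies in `Unr T`. [folklore] -/
theorem mk_of_mem_Unr {T : Subring K} {a : K} {b c : Kˣ} (ha : a ∈ T) (hb : (b : K) ∈ T)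
    (hb' : ((b⁻¹ : Kˣ) : K) ∈ T) (hc : (c : K) ∈ T) (hc' : ((c⁻¹ : Kˣ) : K) ∈ T) :
    ((FreeAbelianGroup.of (a, b, c) : G K) : G K ⧸ N p K) ∈ Unr p K T :=
  AddSubgroup.subset_closure ⟨a, b, c, ha, hb, hb', hc, hc', rfl⟩

/-- `Unr` is monotone in the ring. [folklore] -/
theorem Unr_mono {T T' : Subring K} (h : T ≤ T') : Unr p K T ≤ Unr p K T' :=
  AddSubgroup.closure_mono fun _ ⟨a, b, c, ha, hb, hb', hc, hc', hy⟩ =>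
    ⟨a, b, c, h ha, h hb, h hb', h hc, h hc', hy⟩

/-- If `T` is everything, every class is `T`-integral (symbols generate `G ⧸ N`). [folklore] -/
theorem mem_Unr_of_forall_mem {T : Subring K} (hT : ∀ x : K, x ∈ T) (α : G K ⧸ N p K) :
    α ∈ Unr p K T := by
  induction α using QuotientAddGroup.induction_on with
  | H g =>
    induction g using FreeAbelianGroup.induction_on with
    | zero => rw [QuotientAddGroup.mk_zero]; exact (Unr p K T).zero_mem
    | of x =>
      obtain ⟨a, b, c⟩ := x
      exact mk_of_mem_Unr (hT _) (hT _) (hT _) (hT _) (hT _)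
    | neg x hx => rw [QuotientAddGroup.mk_neg]; exact (Unr p K T).neg_mem hx
    | add x y hx hy => rw [QuotientAddGroup.mk_add]; exact (Unr p K T).add_mem hx hy

theorem Unr_eq_top_of_forall_mem {T : Subring K} (hT : ∀ x : K, x ∈ T) : Unr p K T = ⊤ :=
  eq_top_iff.mpr fun α _ => mem_Unr_of_forall_mem hT α

/-- **`Unr(K) = H³_p(K)`**: at the trivial valuation ring everything is integral. [folklore] -/
theorem Unr_top : Unr p K (⊤ : ValuationSubring K).toSubring = ⊤ :=
  Unr_eq_top_of_forall_mem fun x => ValuationSubring.mem_top x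

/-- Hence (N) `α ∉ Unr(O)` forces `O ≠ ⊤`: the centre `𝔪_O ∩ R` of a witness is non-zero. [folklore] -/
theorem ne_top_of_not_mem_Unr {O : ValuationSubring K} {α : G K ⧸ N p K}
    (hα : α ∉ Unr p K O.toSubring) : O ≠ ⊤ := by
  rintro rfl
  exact hα (by rw [Unr_top]; trivial)

open FreeAbelianGroup in
/-- Additivity in the first slot, in the quotient. [folklore] -/
theorem mk_of_add (a a' : K) (b c : Kˣ) :
    ((of (a + a', b, c) : G K) : G K ⧸ N p K) = (of (a, b, c) : G K) + (of (a', b, c) : G K) := by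
  have h : ((of (a + a', b, c) - of (a, b, c) - of (a', b, c) : G K) : G K ⧸ N p K) = 0 :=
    (QuotientAddGroup.eq_zero_iff _).mpr (AddSubgroup.subset_closure (Or.inl ⟨a, a', b, c, rfl⟩))
  rw [QuotientAddGroup.mk_sub, QuotientAddGroup.mk_sub, sub_sub, sub_eq_zero] at h
  exact h

open FreeAbelianGroup in
/-- `[0, b, c} = 0`. [folklore] -/
theorem mk_of_zero (b c : Kˣ) : ((of ((0 : K), b, c) : G K) : G K ⧸ N p K) = 0 := by
  have h := mk_of_add (p := p) (0 : K) 0 b c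
  rw [add_zero] at h
  simpa using h

open FreeAbelianGroup in
/-- `[n·a, b, c} = n • [a, b, c}`. [folklore] -/
theorem mk_of_natCast_mul (n : ℕ) (a : K) (b c : Kˣ) :
    ((of ((n : K) * a, b, c) : G K) : G K ⧸ N p K) = n • ((of (a, b, c) : G K) : G K ⧸ N p K) := by
  induction n with
  | zero => simp [mk_of_zero]
  | succ n ih => rw [Nat.cast_succ, add_mul, one_mul, mk_of_add, ih, succ_nsmul]

open FreeAbelianGroup in
/-- Every symbol is `p`-torsion when `char K = p`. [folklore] -/
theorem p_nsmul_mk_of [CharP K p] (a : K) (b c : Kˣ) :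
    p • ((of (a, b, c) : G K) : G K ⧸ N p K) = 0 := by
  rw [← mk_of_natCast_mul, CharP.cast_eq_zero, zero_mul, mk_of_zero]

/-- **SANITY: `G ⧸ N` is `p`-torsion** (an `𝔽_p`-vector space), as Kato's `H³_p(K)` must be. [folklore] -/
theorem p_nsmul_eq_zero [CharP K p] (α : G K ⧸ N p K) : p • α = 0 := by
  induction α using QuotientAddGroup.induction_on with
  | H g =>
    induction g using FreeAbelianGroup.induction_on with
    | zero => simp
    | of x => obtain ⟨a, b, c⟩ := x; exact p_nsmul_mk_of a b c
    | neg x hx => rw [QuotientAddGroup.mk_neg, neg_nsmul, hx, neg_zero]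
    | add x y hx hy => rw [QuotientAddGroup.mk_add, nsmul_add, hx, hy, add_zero]

/-- A valuation subring containing the field `k` contains every `k`-integral element of `K`. [folklore] -/
theorem mem_of_isIntegral {k : Type} [Field k] [Algebra k K] (O : ValuationSubring K)
    (hO : ∀ c : k, algebraMap k K c ∈ O) {x : K} (hx : IsIntegral k x) : x ∈ O := by
  obtain ⟨f, hf, hfx⟩ := hx
  let φ : k →+* O := (algebraMap k K).codRestrict O.toSubring fun c => hO c
  have hφ : (algebraMap O K).comp φ = algebraMap k K := RingHom.ext fun _ => rfl
  have hint : IsIntegral O x := ⟨f.map φ, hf.map φ, by rw [Polynomial.eval₂_map, hφ, hfx]⟩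
  have hv : O.valuation.Integers O :=
    ⟨Subtype.val_injective, fun a => O.valuation_le_one a,
      fun r hr => ⟨⟨r, O.mem_of_valuation_le_one r hr⟩, rfl⟩⟩
  exact (O.valuation_le_one_iff x).mp (hv.isIntegral_iff_v_le_one.mp hint)

/-- Degenerate instance trdeg `0`: if `K/k` is algebraic, the only valuation ring of `K` containing `k`
is `K` itself. [folklore] -/
theorem eq_top_of_isAlgebraic {k : Type} [Field k] [Algebra k K] [Algebra.IsAlgebraic k K]
    (O : ValuationSubring K) (hO : ∀ c : k, algebraMap k K c ∈ O) : O = ⊤ := by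
  ext x
  simp only [ValuationSubring.mem_top, iff_true]
  exact mem_of_isIntegral O hO (Algebra.IsAlgebraic.isAlgebraic (R := k) x).isIntegral

/-! ## (a) Load-bearing analysis: the divisorial restriction of the test class -/

/-- The crux with the restriction "W is a DVR essentially of finite type over k" DROPPED from the test
class, everything else verbatim: `α` must now be integral at EVERY valuation ring `W ⊇ R` (with `k ⊆ W`)
centred inside the centre of `O`. [folklore] -/
def WildSymbolWithoutDivisorial : Prop :=
  ∃ p : ℕ, p.Prime ∧ ∃ (k K : Type) (_ : Field k) (_ : CharP k p) (_ : PerfectField k) (_ : Field K)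
    (_ : Algebra k K), (⊤ : IntermediateField k K).FG ∧ ∃ O : ValuationSubring K,
    (∀ c : k, algebraMap k K c ∈ O) ∧ ∃ R : Subalgebra k K, R.FG ∧ R.toSubring ≤ O.toSubring ∧
    IsFractionRing R K ∧ ∃ α : G K ⧸ N p K,
      (∀ W : ValuationSubring K, (∀ c : k, algebraMap k K c ∈ W) → R.toSubring ≤ W.toSubring →
        (∀ x : K, x ∈ R → x ∈ W.nonunits → x ∈ O.nonunits) → α ∈ Unr p K W.toSubring) ∧
      α ∉ Unr p K O.toSubring

/-- **Any construction of a witness must use the divisorial restriction**: without it the statement is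
FALSE — `W := O` is itself a valuation ring containing `R` and `k`, centred inside its own centre.
[folklore] -/
theorem wildSymbol_false_without_divisorial : ¬ WildSymbolWithoutDivisorial := by
  rintro ⟨p, -, k, K, _, _, _, _, _, -, O, hO, R, -, hRO, -, α, hall, hα⟩
  exact hα (hall O hO hRO fun x _ hx => hx)

/-! ## (c) Natural special cases / strengthenings refuted -/

/-- The crux with the extra demand that `O` ITSELF be divisorial (a DVR essentially of finite type over
`k`). [folklore] -/
def WildSymbolWithDivisorialO : Prop :=
  ∃ p : ℕ, p.Prime ∧ ∃ (k K : Type) (_ : Field k) (_ : CharP k p) (_ : PerfectField k) (_ : Field K)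
    (_ : Algebra k K), (⊤ : IntermediateField k K).FG ∧ ∃ O : ValuationSubring K,
    (∀ c : k, algebraMap k K c ∈ O) ∧ IsDiscreteValuationRing O ∧ EssFiniteType k K O ∧
    ∃ R : Subalgebra k K, R.FG ∧ R.toSubring ≤ O.toSubring ∧ IsFractionRing R K ∧
    ∃ α : G K ⧸ N p K, DivIntegral p k K R O α ∧ α ∉ Unr p K O.toSubring

/-- **No witness at a divisorial place**: `O` would be one of the tested `W`. [folklore] -/
theorem not_wildSymbol_with_divisorial_O : ¬ WildSymbolWithDivisorialO := by
  rintro ⟨p, -, k, K, _, _, _, _, _, -, O, hO, hdvr, heft, R, -, hRO, -, α, hdiv, hα⟩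
  exact hα (hdiv O hO hdvr heft hRO fun x _ hx => hx)

/-- The crux with `O := ⊤` (the trivial valuation ring `K`). [folklore] -/
def WildSymbolAtTop : Prop :=
  ∃ p : ℕ, p.Prime ∧ ∃ (k K : Type) (_ : Field k) (_ : CharP k p) (_ : PerfectField k) (_ : Field K)
    (_ : Algebra k K), (⊤ : IntermediateField k K).FG ∧
    ∃ R : Subalgebra k K, R.FG ∧ IsFractionRing R K ∧
    ∃ α : G K ⧸ N p K, DivIntegral p k K R ⊤ α ∧ α ∉ Unr p K (⊤ : ValuationSubring K).toSubring

/-- **No witness at the trivial valuation**: `Unr(K)` is everything. [folklore] -/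
theorem not_wildSymbol_at_top : ¬ WildSymbolAtTop := by
  rintro ⟨p, -, k, K, _, _, _, _, _, -, R, -, -, α, -, hα⟩
  exact hα (by rw [Unr_top]; trivial)

/-- The crux with the extra hypothesis that `K/k` is ALGEBRAIC (trdeg `0`). [folklore] -/
def WildSymbolAlgebraic : Prop :=
  ∃ p : ℕ, p.Prime ∧ ∃ (k K : Type) (_ : Field k) (_ : CharP k p) (_ : PerfectField k) (_ : Field K)
    (_ : Algebra k K), (⊤ : IntermediateField k K).FG ∧ Algebra.IsAlgebraic k K ∧
    ∃ O : ValuationSubring K, (∀ c : k, algebraMap k K c ∈ O) ∧ ∃ R : Subalgebra k K, R.FG ∧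
    R.toSubring ≤ O.toSubring ∧ IsFractionRing R K ∧
    ∃ α : G K ⧸ N p K, DivIntegral p k K R O α ∧ α ∉ Unr p K O.toSubring

/-- **No witness in transcendence degree `0`**: `K/k` algebraic forces `O = ⊤`. [folklore] -/
theorem not_wildSymbol_of_isAlgebraic : ¬ WildSymbolAlgebraic := by
  rintro ⟨p, -, k, K, _, _, _, _, _, -, halg, O, hO, R, -, -, -, α, -, hα⟩
  exact ne_top_of_not_mem_Unr hα (eq_top_of_isAlgebraic O hO)

/-! ## (b) Calibration: the centre of a witness has height ≥ 2 on a normal model (Krull–Akizuki) -/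

/-- An element of `O` that is not a non-unit of `O` has its inverse in `O`. [folklore] -/
theorem inv_mem_of_not_mem_nonunits (O : ValuationSubring K) {b : K} (hbO : b ∈ O)
    (hb : b ∉ O.nonunits) : b⁻¹ ∈ O := by
  have h1 : O.valuation b ≤ 1 := (O.valuation_le_one_iff b).mpr hbO
  have h2 : ¬ O.valuation b < 1 := fun h => hb ((O.mem_nonunits_iff).mpr h)
  have h3 : O.valuation b = 1 := le_antisymm h1 (not_lt.mp h2)
  apply O.mem_of_valuation_le_one
  rw [map_inv₀, h3, inv_one]

/-- The centre `{x ∈ A | x ∈ 𝔪_O}` of `O` on a ring `A → O` is a prime ideal. [folklore] -/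
theorem centre_isPrime (O : ValuationSubring K) {A : Type} [CommRing A] [Algebra A K]
    (hAO : ∀ a : A, algebraMap A K a ∈ O)
    (𝔮 : Ideal A) (h𝔮 : ∀ x : A, x ∈ 𝔮 ↔ algebraMap A K x ∈ O.nonunits) : 𝔮.IsPrime := by
  rw [Ideal.isPrime_iff]
  refine ⟨?_, ?_⟩
  · intro htop
    have h1 : (1 : A) ∈ 𝔮 := by rw [htop]; trivial
    have := (h𝔮 1).mp h1
    rw [map_one, O.mem_nonunits_iff, map_one] at this
    exact lt_irrefl _ this
  · intro x y hxy
    rw [h𝔮, h𝔮]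
    rw [h𝔮, map_mul, O.mem_nonunits_iff, map_mul] at hxy
    by_contra hcon
    push Not at hcon
    obtain ⟨hx, hy⟩ := hcon
    rw [O.mem_nonunits_iff, not_lt] at hx hy
    have hx1 : O.valuation (algebraMap A K x) = 1 :=
      le_antisymm ((O.valuation_le_one_iff _).mpr (hAO x)) hx
    have hy1 : O.valuation (algebraMap A K y) = 1 :=
      le_antisymm ((O.valuation_le_one_iff _).mpr (hAO y)) hy
    rw [hx1, hy1, mul_one] at hxy
    exact lt_irrefl _ hxy

/-- The local ring `A_𝔮 ⊆ K` at a prime `𝔮`, as an explicit subring of `K` (existence form, to keep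
the file usable without new definitions downstream). [folklore] -/
theorem exists_locSubring {A : Type} [CommRing A] [Algebra A K] (𝔮 : Ideal A) [𝔮.IsPrime] :
    ∃ S : Subring K, ∀ x : K, x ∈ S ↔
      ∃ r s : A, s ∉ 𝔮 ∧ x * algebraMap A K s = algebraMap A K r := by
  have h1 : (1 : A) ∉ 𝔮 := fun h => Ideal.IsPrime.ne_top ‹_› ((Ideal.eq_top_iff_one _).mpr h)
  refine ⟨{ carrier := {x | ∃ r s : A, s ∉ 𝔮 ∧ x * algebraMap A K s = algebraMap A K r}
            mul_mem' := ?_, one_mem' := ⟨1, 1, h1, by simp⟩, add_mem' := ?_,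
            zero_mem' := ⟨0, 1, h1, by simp⟩, neg_mem' := ?_ }, fun x => Iff.rfl⟩
  · rintro x y ⟨r, s, hs, hx⟩ ⟨r', s', hs', hy⟩
    refine ⟨r * r', s * s', fun h => ((Ideal.IsPrime.mem_or_mem ‹_› h).elim hs hs'), ?_⟩
    simp only [map_mul]
    calc x * y * (algebraMap A K s * algebraMap A K s')
        = (x * algebraMap A K s) * (y * algebraMap A K s') := by ring
      _ = algebraMap A K r * algebraMap A K r' := by rw [hx, hy]
  · rintro x y ⟨r, s, hs, hx⟩ ⟨r', s', hs', hy⟩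
    refine ⟨r * s' + r' * s, s * s', fun h => ((Ideal.IsPrime.mem_or_mem ‹_› h).elim hs hs'), ?_⟩
    simp only [map_mul, map_add]
    calc (x + y) * (algebraMap A K s * algebraMap A K s')
        = (x * algebraMap A K s) * algebraMap A K s' + (y * algebraMap A K s') * algebraMap A K s := by
          ring
      _ = algebraMap A K r * algebraMap A K s' + algebraMap A K r' * algebraMap A K s := by rw [hx, hy]
  · rintro x ⟨r, s, hs, hx⟩
    exact ⟨-r, s, hs, by simp [neg_mul, hx]⟩

/-- **Krull–Akizuki, normal case (all in Mathlib).** For a Noetherian integrally closed domain `A`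
with fraction field `K` and a non-zero prime `𝔮` of height `≤ 1`, the explicit local ring
`S = A_𝔮 ⊆ K` is a discrete valuation ring of `K`: `S` is the localisation of `A` at `𝔮`
(`IsLocalization.AtPrime`), hence Noetherian, local, integrally closed, of Krull dimension
`ht 𝔮 ≤ 1` (`IsLocalization.AtPrime.ringKrullDim_eq_height`) and not a field, so Dedekind local,
so a DVR (`IsDiscreteValuationRing.TFAE`); a valuation ring of its fraction field `K` contains `x`
or `x⁻¹`. [folklore] -/
theorem locSubring_dvr {A : Type} [CommRing A] [IsDomain A] [Algebra A K] [IsFractionRing A K]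
    [IsNoetherianRing A] [IsIntegrallyClosed A] (𝔮 : Ideal A) [𝔮.IsPrime] (h𝔮 : 𝔮 ≠ ⊥)
    (hht : 𝔮.height ≤ 1) (S : Subring K)
    (hS : ∀ x : K, x ∈ S ↔ ∃ r s : A, s ∉ 𝔮 ∧ x * algebraMap A K s = algebraMap A K r) :
    IsDiscreteValuationRing S ∧ ∀ x : K, x ∈ S ∨ x⁻¹ ∈ S := by
  have hinj : Function.Injective (algebraMap A K) := IsFractionRing.injective A K
  have h1 : (1 : A) ∉ 𝔮 := fun h => Ideal.IsPrime.ne_top ‹_› ((Ideal.eq_top_iff_one _).mpr h)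
  have hAS : ∀ r : A, algebraMap A K r ∈ S := fun r => (hS _).mpr ⟨r, 1, h1, by simp⟩
  let φ : A →+* S := (algebraMap A K).codRestrict S hAS
  letI : Algebra A S := φ.toAlgebra
  have hφ : ∀ r : A, ((algebraMap A S r : S) : K) = algebraMap A K r := fun r => rfl
  -- `S` is the localization of `A` at `𝔮`
  haveI hloc : IsLocalization.AtPrime S 𝔮 := by
    refine (isLocalization_iff _ _).mpr ⟨?_, ?_, ?_⟩
    · rintro ⟨y, hy⟩
      have hy0 : algebraMap A K y ≠ 0 := by
        intro h
        apply hy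
        rw [show y = 0 from hinj (by rw [h, map_zero])]
        exact 𝔮.zero_mem
      have hyinv : (algebraMap A K y)⁻¹ ∈ S :=
        (hS _).mpr ⟨1, y, hy, by rw [inv_mul_cancel₀ hy0, map_one]⟩
      refine IsUnit.of_mul_eq_one ⟨_, hyinv⟩ ?_
      apply Subtype.ext
      show algebraMap A K y * (algebraMap A K y)⁻¹ = 1
      exact mul_inv_cancel₀ hy0
    · rintro ⟨z, hz⟩
      obtain ⟨r, s, hs, h⟩ := (hS z).mp hz
      refine ⟨(r, ⟨s, hs⟩), ?_⟩
      apply Subtype.ext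
      exact h
    · intro r r' h
      refine ⟨1, ?_⟩
      have : algebraMap A K r = algebraMap A K r' := by
        have := congrArg (fun t : S => (t : K)) h
        simpa [hφ] using this
      rw [hinj this]
  haveI : IsLocalRing S := IsLocalization.AtPrime.isLocalRing S 𝔮
  haveI : IsNoetherianRing S := IsLocalization.isNoetherianRing 𝔮.primeCompl S inferInstance
  haveI : IsIntegrallyClosed S :=
    isIntegrallyClosed_of_isLocalization S 𝔮.primeCompl (Ideal.primeCompl_le_nonZeroDivisors 𝔮)
  have hdim : ringKrullDim S ≤ 1 := by
    rw [IsLocalization.AtPrime.ringKrullDim_eq_height 𝔮 S]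
    exact_mod_cast hht
  haveI : Ring.KrullDimLE 1 S := (Ring.krullDimLE_iff).mpr hdim
  haveI : Ring.DimensionLEOne S := ⟨fun hp hprime => hprime.isMaximal_of_ne_bot hp⟩
  haveI : IsDedekindRing S := {}
  -- not a field: a non-zero element of `𝔮` is a non-unit of `S`
  have hnf : ¬ IsField S := by
    intro hF
    obtain ⟨q, hq𝔮, hq0⟩ := Submodule.exists_mem_ne_zero_of_ne_bot h𝔮
    have hmax : algebraMap A S q ∈ IsLocalRing.maximalIdeal S :=
      (IsLocalization.AtPrime.to_map_mem_maximal_iff S 𝔮 q).mpr hq𝔮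
    have hq0' : algebraMap A S q ≠ 0 := by
      intro h
      apply hq0
      apply hinj
      rw [map_zero, ← hφ, h]
      rfl
    obtain ⟨t, ht⟩ := hF.mul_inv_cancel hq0'
    exact (IsLocalRing.maximalIdeal.isMaximal S).ne_top
      (Ideal.eq_top_of_isUnit_mem _ hmax (IsUnit.of_mul_eq_one t ht))
  have hDD : IsDedekindDomain S := inferInstance
  have hdvr : IsDiscreteValuationRing S :=
    ((IsDiscreteValuationRing.TFAE S hnf).out 0 2).mpr hDD
  refine ⟨hdvr, fun x => ?_⟩
  -- every element of `K` is in `S` or has its inverse in `S`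
  obtain ⟨a, b, hb, rfl⟩ := IsFractionRing.div_surjective (A := A) x
  have hb0 : algebraMap A K b ≠ 0 :=
    fun h => nonZeroDivisors.ne_zero hb (hinj (by rw [h, map_zero]))
  obtain ⟨c, hc⟩ := ValuationRing.cond (algebraMap A S a) (algebraMap A S b)
  rcases hc with hc | hc
  · right
    have hcK : algebraMap A K a * (c : K) = algebraMap A K b := by
      have := congrArg (fun t : S => (t : K)) hc
      simpa [hφ] using this
    have ha0 : algebraMap A K a ≠ 0 := by
      intro h
      rw [h, zero_mul] at hcK
      exact hb0 hcK.symm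
    have : (algebraMap A K a / algebraMap A K b)⁻¹ = (c : K) := by
      rw [inv_div, ← hcK]; field_simp
    rw [this]; exact c.2
  · left
    have hcK : algebraMap A K b * (c : K) = algebraMap A K a := by
      have := congrArg (fun t : S => (t : K)) hc
      simpa [hφ] using this
    have : algebraMap A K a / algebraMap A K b = (c : K) := by
      rw [← hcK]; field_simp
    rw [this]; exact c.2

/-- The crux with the extra hypotheses "`R` is integrally closed in `K`" and "the centre
`𝔮 = 𝔪_O ∩ R` has height `≤ 1`" (the centre given by its membership condition). [folklore] -/
def WildSymbolCentreHeightLeOne : Prop :=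
  ∃ p : ℕ, p.Prime ∧ ∃ (k K : Type) (_ : Field k) (_ : CharP k p) (_ : PerfectField k) (_ : Field K)
    (_ : Algebra k K), (⊤ : IntermediateField k K).FG ∧ ∃ O : ValuationSubring K,
    (∀ c : k, algebraMap k K c ∈ O) ∧ ∃ R : Subalgebra k K, R.FG ∧ R.toSubring ≤ O.toSubring ∧
    IsFractionRing R K ∧ IsIntegrallyClosedIn R K ∧
    (∃ 𝔮 : Ideal R, (∀ x : R, x ∈ 𝔮 ↔ (x : K) ∈ O.nonunits) ∧ 𝔮.height ≤ 1) ∧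
    ∃ α : G K ⧸ N p K, DivIntegral p k K R O α ∧ α ∉ Unr p K O.toSubring

/-- **CALIBRATION (height-one centre on a normal model): no witness.** `𝔮 ≠ 0` (else `Frac R ⊆ O`,
`O = ⊤`); `R_𝔮 ⊆ K` is a DVR of `K` (`locSubring_dvr`) dominated by `O`, so `O = R_𝔮`
(`ValuationSubring.eq_self_or_eq_top_of_le`, `O ≠ ⊤`) is divisorial with `B := R` and is itself a
tested `W` — contradiction. Hence the centre of any witness on a NORMAL affine model has height
`≥ 2` (codimension ≥ 2 on the normalisation). [folklore] -/
theorem not_wildSymbol_of_centre_height_le_one : ¬ WildSymbolCentreHeightLeOne := by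
  rintro ⟨p, -, k, K, _, _, _, _, _, -, O, hO, R, hR, hRO, hfr, hic, ⟨𝔮, h𝔮, hht⟩, α, hdiv, hα⟩
  haveI : Algebra.FiniteType k R := R.fg_iff_finiteType.mp hR
  haveI : IsNoetherianRing R := Algebra.FiniteType.isNoetherianRing k R
  haveI : IsFractionRing R K := hfr
  haveI : IsIntegrallyClosed R := (isIntegrallyClosed_iff_isIntegrallyClosedIn K).mpr hic
  have hRO' : ∀ a : R, algebraMap R K a ∈ O := fun a => hRO a.2
  haveI h𝔮p : 𝔮.IsPrime := centre_isPrime O hRO' 𝔮 h𝔮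
  have hOtop : O ≠ ⊤ := ne_top_of_not_mem_Unr hα
  -- the centre is non-zero, for otherwise `K = Frac R ⊆ O`
  have h𝔮0 : 𝔮 ≠ ⊥ := by
    intro h
    apply hOtop
    ext x
    simp only [ValuationSubring.mem_top, iff_true]
    obtain ⟨a, b, hb, rfl⟩ := IsFractionRing.div_surjective (A := R) x
    have hb𝔮 : b ∉ 𝔮 := by
      rw [h, Ideal.mem_bot]
      exact nonZeroDivisors.ne_zero hb
    have hbinv : (algebraMap R K b)⁻¹ ∈ O :=
      inv_mem_of_not_mem_nonunits O (hRO' b) (fun hh => hb𝔮 ((h𝔮 b).mpr hh))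
    rw [div_eq_mul_inv]
    exact O.mul_mem _ _ (hRO' a) hbinv
  -- `S = R_𝔮 ⊆ K` is a DVR of `K`, dominated by `O`
  obtain ⟨S, hS⟩ := exists_locSubring (A := R) (K := K) 𝔮
  obtain ⟨hdvr, hval⟩ := locSubring_dvr 𝔮 h𝔮0 hht S hS
  let V : ValuationSubring K := ⟨S, hval⟩
  have hSO : ∀ x : K, x ∈ S → x ∈ O := by
    intro x hx
    obtain ⟨r, s, hs, h⟩ := (hS x).mp hx
    have hsinv : (algebraMap R K s)⁻¹ ∈ O :=
      inv_mem_of_not_mem_nonunits O (hRO' s) (fun hh => hs ((h𝔮 s).mpr hh))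
    have hsK : algebraMap R K s ≠ 0 := by
      intro h0
      apply hs
      have : s = 0 := IsFractionRing.injective R K (by rw [h0, map_zero])
      rw [this]; exact 𝔮.zero_mem
    have hx' : x = algebraMap R K r * (algebraMap R K s)⁻¹ := by
      rw [← h, mul_assoc, mul_inv_cancel₀ hsK, mul_one]
    rw [hx']
    exact O.mul_mem _ _ (hRO' r) hsinv
  have hVO : V ≤ O := fun x hx => hSO x hx
  haveI : IsDiscreteValuationRing V := hdvr
  rcases ValuationSubring.eq_self_or_eq_top_of_le hVO with hVO' | htop
  · apply hα
    refine hdiv O hO ?_ ?_ hRO (fun x _ hx => hx)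
    · rw [← hVO']; infer_instance
    · refine ⟨R, hR, hRO, fun x hx => ?_⟩
      have hxS : x ∈ S := by rw [← hVO'] at hx; exact hx
      obtain ⟨r, s, hs, h⟩ := (hS x).mp hxS
      exact ⟨r, s, r.2, s.2, fun hh => hs ((h𝔮 s).mpr hh), h⟩
  · exact hOtop htop

/-- The crux with the extra hypotheses `Algebra.trdeg k K ≤ 1` and "`R` integrally closed in `K`".
[folklore] -/
def WildSymbolTrdegLeOneNormal : Prop :=
  ∃ p : ℕ, p.Prime ∧ ∃ (k K : Type) (_ : Field k) (_ : CharP k p) (_ : PerfectField k) (_ : Field K)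
    (_ : Algebra k K), (⊤ : IntermediateField k K).FG ∧ Algebra.trdeg k K ≤ 1 ∧
    ∃ O : ValuationSubring K, (∀ c : k, algebraMap k K c ∈ O) ∧ ∃ R : Subalgebra k K, R.FG ∧
    R.toSubring ≤ O.toSubring ∧ IsFractionRing R K ∧ IsIntegrallyClosedIn R K ∧
    ∃ α : G K ⧸ N p K, DivIntegral p k K R O α ∧ α ∉ Unr p K O.toSubring

/-- **No witness on a normal affine model of a curve (trdeg ≤ 1).** `dim R = trdeg_k K ≤ 1`
(`Literature…ringKrullDim_le_of_fg_of_trdeg_le`), so the centre has height `≤ 1` and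
`not_wildSymbol_of_centre_height_le_one` applies. [cite: Matsumura1987, Thm. 5.6] -/
theorem not_wildSymbol_of_trdeg_le_one_of_normal : ¬ WildSymbolTrdegLeOneNormal := by
  rintro ⟨p, hp, k, K, ik, icp, ipf, iK, ialg, hfg, htr, O, hO, R, hR, hRO, hfr, hic, α, hdiv, hα⟩
  haveI : IsFractionRing R K := hfr
  have hRO' : ∀ a : R, algebraMap R K a ∈ O := fun a => hRO a.2
  -- the centre of `O` on `R`, as an ideal
  let 𝔮 : Ideal R :=
    { carrier := {x | (x : K) ∈ O.nonunits}
      add_mem' := fun {x y} hx hy => by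
        show ((x + y : R) : K) ∈ O.nonunits
        rw [Subalgebra.coe_add]
        exact O.nonunits.add_mem hx hy
      zero_mem' := by
        show ((0 : R) : K) ∈ O.nonunits
        rw [Subalgebra.coe_zero]
        exact O.nonunits.zero_mem
      smul_mem' := fun c x hx => by
        show ((c * x : R) : K) ∈ O.nonunits
        rw [Subalgebra.coe_mul, O.mem_nonunits_iff, map_mul]
        calc O.valuation (c : K) * O.valuation (x : K) ≤ 1 * O.valuation (x : K) :=
              mul_le_mul_left ((O.valuation_le_one_iff _).mpr (hRO' c)) _
          _ = O.valuation (x : K) := one_mul _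
          _ < 1 := (O.mem_nonunits_iff).mp hx }
  have h𝔮 : ∀ x : R, x ∈ 𝔮 ↔ (x : K) ∈ O.nonunits := fun x => Iff.rfl
  haveI : 𝔮.IsPrime := centre_isPrime O hRO' 𝔮 h𝔮
  have hdim : ringKrullDim R ≤ (1 : ℕ) :=
    Literature.AlgebraicGeometry.Resolution.ringKrullDim_le_of_fg_of_trdeg_le R hR
      (by exact_mod_cast htr)
  have hht : 𝔮.height ≤ 1 := by
    have h := (Ideal.height_le_ringKrullDim_of_isPrime (I := 𝔮)).trans hdim
    exact_mod_cast h
  exact not_wildSymbol_of_centre_height_le_one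
    ⟨p, hp, k, K, ik, icp, ipf, iK, ialg, hfg, O, hO, R, hR, hRO, hfr, hic, ⟨𝔮, h𝔮, hht⟩, α, hdiv, hα⟩

/-! ## (e) Near-misses (sorried here ONLY; statements precise) -/

/-- **NEAR-MISS (transcendence degree ≤ 1, arbitrary affine model `R`; the NORMAL case is
`not_wildSymbol_of_trdeg_le_one_of_normal` above).** No witness with `trdeg_k K ≤ 1`: every valuation ring
`O ∌ K` of a one-variable function field over `k` is a local ring of the (finite!) normalisation of an
affine model, hence divisorial and tested. Obstruction: finiteness of the normalisation of a finitely
generated `k`-domain (Noether) — resp. existence of a separating transcendence basis over perfect `k`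
plus `IsIntegralClosure.finite` — is not in Mathlib. [folklore] -/
theorem not_wildSymbol_of_trdeg_le_one :
    ¬ ∃ p : ℕ, p.Prime ∧ ∃ (k K : Type) (_ : Field k) (_ : CharP k p) (_ : PerfectField k) (_ : Field K)
      (_ : Algebra k K), (⊤ : IntermediateField k K).FG ∧ Algebra.trdeg k K ≤ 1 ∧
      ∃ O : ValuationSubring K, (∀ c : k, algebraMap k K c ∈ O) ∧ ∃ R : Subalgebra k K, R.FG ∧
      R.toSubring ≤ O.toSubring ∧ IsFractionRing R K ∧
      ∃ α : G K ⧸ N p K, DivIntegral p k K R O α ∧ α ∉ Unr p K O.toSubring := by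
  sorry

end Summit.ResolutionOfSingularities.ResolutionOfSingularities.Cruxes.WildSymbol.Disproof

end
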